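import Mathlib
import HarnessLib
import Summits.Langlands.Langlands.Theses.ExteriorSquareAscent
import Summits.Langlands.Langlands.Theorems.ExteriorSquareAscentInducedSquareAscentStubGalConjDatum
import Summits.Langlands.Langlands.Theorems.ExteriorSquareAscentInducedSquareAscentStubUnitaryReduction
import Summits.Langlands.Langlands.Theorems.ExteriorSquareAscentInducedSquareAscentStubCentralCharacterDescent
import Summits.Langlands.Langlands.Theorems.ExteriorSquareAscentInducedSquareAscentStubDualityDichotomy
import Summits.Langlands.Langlands.Theorems.ExteriorSquareAscentInducedSquareAscentStubKleinCubePole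

/-!
# `InducedSquareAscent` (crux stmt-Langlands-18053 of route `ExteriorSquareAscent`) from
# Jacquet–Shalika (2.2)/(2.3) — the Klein-cube line assembled

The rank-2 crux `Summit.Langlands.Langlands.Theses.ExteriorSquareAscent.InducedSquareAscent` (THE LEVER
of the route): `π` cuspidal on `GL₄(𝔸_K)`, `L/K` quadratic, `P` cuspidal on `GL₃(𝔸_L)` whose
automorphic-induction Satake data are the exterior-square Satake data of `π` a.e. ⟹ `π` is essentially
self-dual at Satake level OR quadratically self-twisted a.e.

This file proves it CONDITIONALLY on the two named facts of `PairLFunctionPolesRepData` —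
Arthur–Clozel Ch. 3 (2.2) and (2.3) for Borel–Jacquet data (`JacquetShalika1981_partialPairL_boundary_repData`,
`JacquetShalika1981_partialPairL_pole_repData`; Jacquet–Shalika 1981 II Prop. 3.6 with Shahidi's
non-vanishing) — and on NOTHING ELSE: no base change of `π`, no Kim exterior square, no Asgari–Raghuram,
no fibre theorem, no class-field existence theorem. The line (idea card `klein-cube-pole-transfer`):
reduce to unitary data (`stub_unitaryReduction`), conjugate `P` by the non-trivial automorphism `τ` of
`L/K` (`stub_galConjDatum`), run the duality dichotomy (`stub_dualityDichotomy`: identities (A), (B')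
of the line + pole counting) — either `π` is `ε_{L/K}`-self-twisted (second disjunct with `L' := L`),
or Case I holds, the central character of `P` descends (`stub_centralCharacterDescent`) and the Klein
cube pole (`stub_kleinCubePole`: identity (✦), the automorphic `A₃ = D₃` plethysm
`∧³∘∧² = Sym²⊗det ⊕ Sym²ᵛ⊗det²`) makes `π` essentially self-dual (first disjunct).
-/

set_option linter.unusedVariables false
set_option linter.dupNamespace false

noncomputable section

namespace Summit.Langlands.Langlands.Theorems.InducedSquareAscentKleinCube

open scoped Classical NumberField
open Filter IsDedekindDomain NumberField
open Summit.Langlands.Langlands.Theses.ExteriorSquareAscent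
open Literature.NumberTheory.Automorphic
open Literature.NumberTheory.GaloisRepresentations (HeckeCharacter)

/-- A quadratic extension of number fields is Galois and has a non-trivial automorphism. [folklore] -/
theorem isGalois_and_exists_ne_one_of_finrank_eq_two (K L : Type) [Field K] [NumberField K] [Field L]
    [NumberField L] [Algebra K L] (hdeg : Module.finrank K L = 2) :
    IsGalois K L ∧ ∃ τ : L ≃ₐ[K] L, τ ≠ 1 := by
  haveI : FiniteDimensional K L := Module.finite_of_finrank_pos (by omega)
  haveI : Algebra.IsQuadraticExtension K L := { finrank_eq_two' := hdeg }
  haveI hG : IsGalois K L := inferInstance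
  refine ⟨hG, ?_⟩
  have hcard : Fintype.card (L ≃ₐ[K] L) = 2 := by
    rw [← hdeg, ← IsGalois.card_aut_eq_finrank, Fintype.card_eq_nat_card]
  by_contra h
  push Not at h
  have : Fintype.card (L ≃ₐ[K] L) ≤ 1 := Fintype.card_le_one_iff.mpr fun a b => by rw [h a, h b]
  omega

/-- **`InducedSquareAscent` from Jacquet–Shalika (2.2) and (2.3)** (CONDITIONAL result: the two
hypotheses are the named facts `JacquetShalika1981_partialPairL_boundary_repData`,
`JacquetShalika1981_partialPairL_pole_repData` of `PairLFunctionPolesRepData`, Arthur–Clozel Ch. 3 §2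
(2.2)–(2.3); everything else is proved — see the module docstring for the line). The conclusion is the
route decl `Summit.Langlands.Langlands.Theses.ExteriorSquareAscent.InducedSquareAscent`, by name.
[cite: ArthurClozelAMS120, Ch. 3 §2 (2.2)–(2.3)] [cite: JacquetShalikaAJM1981II, Prop. 3.6 and Thm. 4.4] -/
theorem InducedSquareAscent_of_jacquetShalika
    (h22 : JacquetShalika1981_partialPairL_boundary_repData)
    (h23 : JacquetShalika1981_partialPairL_pole_repData) :
    Summit.Langlands.Langlands.Theses.ExteriorSquareAscent.InducedSquareAscent := by
  intro K _ _ h1 hcpt π L _ _ _ hdeg hL3 P hmatch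
  obtain ⟨hGal, τ, hτ⟩ := isGalois_and_exists_ne_one_of_finrank_eq_two K L hdeg
  haveI : IsGalois K L := hGal
  -- unitary reduction
  obtain ⟨π₀, P₀, hUπ, hUP, hmatch₀, hD1, hD2⟩ := stub_unitaryReduction K h1 hcpt π L hdeg hL3 P hmatch
  -- the Galois-conjugate datum `P₀^τ`
  obtain ⟨P', hP'⟩ := stub_galConjDatum 3 K L hL3 τ P₀
  -- the dichotomy
  rcases stub_dualityDichotomy K L hdeg τ hτ hcpt hL3 π₀ P₀ h22 h23 hUπ hUP hmatch₀ ⟨P', hP'⟩ with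
    hst | hcaseI
  · -- `π` is `ε_{L/K}`-self-twisted: the crux's second disjunct with `L' := L`
    exact Or.inr ⟨L, inferInstance, inferInstance, inferInstance, hdeg, hD2 hst⟩
  · -- Case I: descend the central character, then the Klein cube pole
    have hNZπ : ∀ᶠ v : HeightOneSpectrum (𝓞 K) in cofinite, ∀ α : Multiset ℂ,
        π₀.1.HasSatakeParamAt v α → ∀ a ∈ α, a ≠ 0 :=
      hUπ.mono fun v hv α hα => (hv α hα).2
    have hNZP : ∀ᶠ w : HeightOneSpectrum (𝓞 L) in cofinite, ∀ β : Multiset ℂ,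
        P₀.1.HasSatakeParamAt w β → ∀ b ∈ β, b ≠ 0 :=
      hUP.mono fun w hw β hβ => (hw β hβ).2
    obtain ⟨μ, hμ⟩ :=
      stub_centralCharacterDescent K L hdeg τ hτ hcpt hL3 π₀ P₀ hNZπ hNZP hmatch₀ hcaseI
    obtain ⟨χ, hχ⟩ :=
      stub_kleinCubePole K L hdeg τ hτ hcpt hL3 π₀ P₀ h22 h23 hUπ hUP hmatch₀ ⟨P', hP'⟩ μ hμ
    exact Or.inl (hD1 ⟨χ, hχ⟩)

end Summit.Langlands.Langlands.Theorems.InducedSquareAscentKleinCube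

end
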